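/-
Copyright (c) 2026 the pub-hodgecm-mathlib formalisation cell (harness21).  Prover seat hodgecm-mathlib-F0P2-p01 (g15): road «S3-ram» (LEAD F0P3a-plan (g12); architect
A-p16 (g31); junction pen F0P3a-p01 (g17), J-PACK v2 03ef5f1f ROW-P; owner F0P3a-p06 (g15)); 2026-09-02.
-/
import Literature.NumberTheory.Automorphic.UnitaryLatticeTreeFixedRowEvenRamified   -- ★ p847526 (this seat): ROW-E template, `conj_mul_eq_inv_mul_conj_mul`; brings ★ M₂, M, L, K, J, I, H, G3⁺, G3⁵
import HarnessLib

/-!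
# The lattice graph of a hermitian space — ROW-P OF THE TREE INDUCTION (tame-ramified place): the fixed grandchildren of an odd-depth RANK-ONE vertex `P^c_{m+1}` are
# `q²` vertices of depth exactly `d − 2`, rank `≤ 1` and class `−c` (Bruhat–Tits 1972 §10; Tits 1979 §3.5; Kottwitz 1986 §3)

Topic `NumberTheory/Automorphic`; namespace `Literature.NumberTheory.Automorphic.UnitaryLatticeTree`.  THEOREMS ONLY (no definition, no instance, no notation, no named fact,
no `sorry`); kernel lane `--supports stmt-HodgeConjecture-24833`.  Cell `pub/hodgecm-mathlib` (D-0151), crux H413; road «S3-ram» (Literature seeding, count-neutral), organ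
A′ (ii) of the P-1-ram skeleton (architect A-p16 (g31)); junction J-PACK v2 (F0P3a-p01 (g17)) **ROW-P** «ODD RANK-ONE VERTEX `P^c_{m+1}`: CLASS FLIP BY `−1`», the `hP`
hypothesis of the engine ★ p847302 in TOKEN currency (socket `row_P` of the junction skeleton; binder order verbatim; `hγ0`, `hdo` unused and `_`-prefixed).  J₀-MODEL.

THE STATEMENT.  For a fixed self-dual vertex `v ≠ r₀` of depth exactly `d ≥ 3` (`LEV[v](ϖ^d)`, `¬LEV[v](ϖ^{d+1})`), rank `≤ 1` (`LEV₂[v](ϖ^{2d+1})`), residually nilpotent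
(`LEV₃[v](ϖ^{3d+1})`), of class `c` (`CLS[v] d c`, `|c| = 1`), oriented by `(p, g, hup)`: **every fixed grandchild `w ∈ GC(v)` has
`LEV[w](ϖ^{d−2}) ∧ ¬LEV[w](ϖ^{d−1}) ∧ LEV₂[w](ϖ^{2d−3}) ∧ CLS[w] (d−2) (−c)`, and `#GC(v) = q²`** — the law `P^c → q²·P^{χ(−1)c}` (CERT «child-class flip» B-p14 (g39); ★ F (S)).

THE PROOF.  `v = u·L₀`; the inward frame `u₀ = uκ₀` (★ L on `p, g`) carries `Y₀ = u₀⁻¹(γ−1)u₀` of level `ϖ^d`, `Y₀²` of level `ϖ^{2d+1}`, `Y₀³` of level `ϖ^{3d+1}` (★ G3⁵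
dictionary) with vanishing first column (★ J §1 eigenline from `hup` + §2 nilpotency); ★ K: `Ȳ₀ = s·E₀₂` (`forall_v_coe_sub_one_le_succ_of_sq_le_of_col`), and exact depth makes
`|Y₀ 0 2| = |ϖ|^d`; the vertex class token pins `(ϖ^d)⁻¹Y₀ 0 2 ≡ c·□` (★ K `v_B₀_mulVec_sub_sq_mul_lt_of_shape`).  A grandchild `w = latt((uκ)·g(a,b))` over the OUTWARD
`c = (uκ)·N₁` (★ L) has `k := κ₀⁻¹κ` with `k·N₁ ≠ N₁`, so `|k₂₀| = 1` (★ K `mapGL_N₁_eq_iff_v_apply_two_zero_lt_one`), the corner of `k⁻¹Y₀k` is a UNIT multiple of `ϖ^d`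
(★ K `v_conj_apply_two_zero_le_iff_of_shape`) of class `c·□` (★ K `v_conj_apply_two_zero_sub_lt_of_shape`); ★ H gives the four tokens at `w` (`…_pred_pred`, `…_pred_iff`,
`…_sq_…_of_le`, `exists_mem_childLatt_class_neg_of_lineClass`); the count is ★ G3⁺ `ncard_fixedGrandchildren_eq_sq_of_level_two`.

* `exists_unit_class_of_cls_of_shape` (the vertex class token pins the class of `Y₀ 0 2`), **`fixedGrandchildren_tokens_and_ncard_of_rankOne`** (ROW-P).

HONEST LABEL: HC_CM is proved only modulo the 2 remaining named inputs (hLiu418 24832, h413 24833) until rung 0 closes; nothing printed is asserted here (elementary lattice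
bookkeeping over a valuation ring); «S3-ram» has no books consequence.

## References
* [BruhatTits1972] F. Bruhat, J. Tits, *Groupes réductifs sur un corps local I*, Publ. Math. IHÉS 41 (1972), §10 (lattice models; vertex stabilisers and their filtrations).
* [Tits1979] J. Tits, *Reductive groups over local fields*, PSPM 33.1 (1979), §3.5 (congruence filtration; reduction mod `𝔭`).
* [Kottwitz1986] R. E. Kottwitz, *Base change for unit elements of Hecke algebras*, Compositio Math. 60 (1986), §3 (counting fixed lattices shell by shell).
* [Serre1980Trees] J.-P. Serre, *Trees* (1980), Ch. II §1.1 (neighbours of a lattice = lines of its reduction; balls in the tree).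
-/

set_option autoImplicit false

noncomputable section

open scoped Valued WithZero Matrix MatrixGroups

namespace Literature.NumberTheory.Automorphic.UnitaryLatticeTree

open Literature.NumberTheory.Automorphic Literature.NumberTheory.Automorphic.HermitianLattice

variable {K : Type*} [Field K] [Valued K ℤᵐ⁰] {σ : K →+* K} {ϖ : K}

/-- **The vertex class token pins the class of `Y 0 2`**: for unitary `u` and `Y := u⁻¹(γ−1)u` of level `ϖ^d` with the rank-one SHAPE (every entry but `(0,2)` is
`≤ |ϖ|^{d+1}`, ★ K), if some `y ∈ latt u` has `(ϖ^d)⁻¹·pairing(y, (γ−1)y) ≡ c·a²` (`|a| = 1`, `|c| = 1`) then `(ϖ^d)⁻¹·Y 0 2 ≡ c·a₁²` for a unit `a₁`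
(`B₀(z, Yz) ≡ z₂²·Y 0 2`, ★ K `v_B₀_mulVec_sub_sq_mul_lt_of_shape`). [cite: Kottwitz1986, §3] [cite: Tits1979, §3.5] -/
theorem exists_unit_class_of_cls_of_shape (hvσ : ∀ z, Valued.v (σ z) = Valued.v z) (hϖ : Valued.v ϖ = WithZero.exp (-1 : ℤ))
    (hres : ∀ x : K, Valued.v x ≤ 1 → Valued.v (σ x - x) < 1)
    (u γ : unitaryGroupOfForm σ ((StdForm.antidiagonal 3).over K)) {d : ℕ}
    (hY : ∀ i j, Valued.v ((((((u : unitaryGroupOfForm σ ((StdForm.antidiagonal 3).over K)) : GL (Fin 3) K)⁻¹ : GL (Fin 3) K) : Matrix (Fin 3) (Fin 3) K) * (((γ : GL (Fin 3) K) : Matrix (Fin 3) (Fin 3) K) - 1) * (((u : unitaryGroupOfForm σ ((StdForm.antidiagonal 3).over K)) : GL (Fin 3) K) : Matrix (Fin 3) (Fin 3) K)) i j) ≤ Valued.v ϖ ^ d)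
    (hshape : ∀ i j : Fin 3, ¬ (i = 0 ∧ j = 2) → Valued.v ((((((u : unitaryGroupOfForm σ ((StdForm.antidiagonal 3).over K)) : GL (Fin 3) K)⁻¹ : GL (Fin 3) K) : Matrix (Fin 3) (Fin 3) K) * (((γ : GL (Fin 3) K) : Matrix (Fin 3) (Fin 3) K) - 1) * (((u : unitaryGroupOfForm σ ((StdForm.antidiagonal 3).over K)) : GL (Fin 3) K) : Matrix (Fin 3) (Fin 3) K)) i j) ≤ Valued.v ϖ ^ (d + 1))
    {c : K} (hc : Valued.v c = 1)
    (hcls : ∃ y ∈ latt (((u : unitaryGroupOfForm σ ((StdForm.antidiagonal 3).over K)) : GL (Fin 3) K) : Matrix (Fin 3) (Fin 3) K), ∃ a : K, Valued.v a = 1 ∧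
      Valued.v ((ϖ ^ d)⁻¹ * pairing σ ((StdForm.antidiagonal 3).over K) y ((((γ : GL (Fin 3) K) : Matrix (Fin 3) (Fin 3) K) - 1) *ᵥ y) - c * a ^ 2) < 1) :
    ∃ a₁ : K, Valued.v a₁ = 1 ∧ Valued.v ((ϖ ^ d)⁻¹ * (((((u : unitaryGroupOfForm σ ((StdForm.antidiagonal 3).over K)) : GL (Fin 3) K)⁻¹ : GL (Fin 3) K) : Matrix (Fin 3) (Fin 3) K) * (((γ : GL (Fin 3) K) : Matrix (Fin 3) (Fin 3) K) - 1) * (((u : unitaryGroupOfForm σ ((StdForm.antidiagonal 3).over K)) : GL (Fin 3) K) : Matrix (Fin 3) (Fin 3) K)) 0 2 - c * a₁ ^ 2) < 1 := by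
  have hϖ0 : ϖ ≠ 0 := fun h0 => by rw [h0, map_zero] at hϖ; exact WithZero.coe_ne_zero hϖ.symm
  have hvϖ0 : Valued.v ϖ ≠ 0 := (Valuation.ne_zero_iff _).2 hϖ0
  have hpd : Valued.v ((ϖ ^ d)⁻¹) = (Valued.v ϖ ^ d)⁻¹ := by rw [map_inv₀, map_pow]
  obtain ⟨y, hy, a, ha, hval⟩ := hcls
  set Y : Matrix (Fin 3) (Fin 3) K := (((((u : unitaryGroupOfForm σ ((StdForm.antidiagonal 3).over K)) : GL (Fin 3) K)⁻¹ : GL (Fin 3) K) : Matrix (Fin 3) (Fin 3) K) * (((γ : GL (Fin 3) K) : Matrix (Fin 3) (Fin 3) K) - 1) * (((u : unitaryGroupOfForm σ ((StdForm.antidiagonal 3).over K)) : GL (Fin 3) K) : Matrix (Fin 3) (Fin 3) K)) with hYdef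
  -- `y = u z` with `z ∈ 𝒪³`
  have hy' := hy
  rw [latt, Submodule.mem_map] at hy'
  obtain ⟨z, hz, hzy⟩ := hy'
  rw [LinearMap.restrictScalars_apply, Matrix.toLin'_apply] at hzy
  have hz1 : ∀ i, Valued.v (z i) ≤ 1 := mem_stdLattice.1 hz
  -- `pairing(y, (γ−1)y) = B₀(z, Yz)`
  have hκu := (mem_unitaryGroupOfForm_antidiagonal_iff ((u : unitaryGroupOfForm σ ((StdForm.antidiagonal 3).over K)) : GL (Fin 3) K)).1 u.2
  have hpair : pairing σ ((StdForm.antidiagonal 3).over K) y ((((γ : GL (Fin 3) K) : Matrix (Fin 3) (Fin 3) K) - 1) *ᵥ y) = B₀ σ 3 z (Y.mulVec z) := by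
    rw [← hzy, pairing_antidiagonal, mulVec_coe_inv_mul_mul, hκu]
  rw [hpair] at hval
  -- `|B₀(z, Yz) − z₂²·Y 0 2| < |ϖ|^d`
  have hform := v_B₀_mulVec_sub_sq_mul_lt_of_shape hvσ hϖ hres hY hshape hz1
  -- rescale: `|(ϖ^d)⁻¹(B₀ − z₂² Y₀₂)| < 1`
  have h1 : Valued.v ((ϖ ^ d)⁻¹ * (B₀ σ 3 z (Y.mulVec z) - z 2 ^ 2 * Y 0 2)) < 1 := by
    rw [map_mul, hpd]
    calc (Valued.v ϖ ^ d)⁻¹ * Valued.v (B₀ σ 3 z (Y.mulVec z) - z 2 ^ 2 * Y 0 2) < (Valued.v ϖ ^ d)⁻¹ * Valued.v ϖ ^ d :=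
          mul_lt_mul_of_pos_left hform (zero_lt_iff.2 (inv_ne_zero (pow_ne_zero _ hvϖ0)))
      _ = 1 := inv_mul_cancel₀ (pow_ne_zero _ hvϖ0)
  -- hence `|(ϖ^d)⁻¹ z₂² Y₀₂ − c a²| < 1`
  have h2 : Valued.v ((ϖ ^ d)⁻¹ * (z 2 ^ 2 * Y 0 2) - c * a ^ 2) < 1 := by
    have e : (ϖ ^ d)⁻¹ * (z 2 ^ 2 * Y 0 2) - c * a ^ 2 = ((ϖ ^ d)⁻¹ * B₀ σ 3 z (Y.mulVec z) - c * a ^ 2) - (ϖ ^ d)⁻¹ * (B₀ σ 3 z (Y.mulVec z) - z 2 ^ 2 * Y 0 2) := by ring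
    rw [e]; exact Valuation.map_sub_lt _ hval h1
  -- `|c a²| = 1`, so `|(ϖ^d)⁻¹ z₂² Y₀₂| = 1`, hence `|z₂| = 1`
  have hca : Valued.v (c * a ^ 2) = 1 := by rw [map_mul, map_pow, hc, ha, one_pow, one_mul]
  have hmain : Valued.v ((ϖ ^ d)⁻¹ * (z 2 ^ 2 * Y 0 2)) = 1 := by
    rw [← hca]; exact Valuation.map_eq_of_sub_lt _ (by rw [hca]; exact h2)
  have hY02 : Valued.v ((ϖ ^ d)⁻¹ * Y 0 2) ≤ 1 := by
    rw [map_mul, hpd]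
    calc (Valued.v ϖ ^ d)⁻¹ * Valued.v (Y 0 2) ≤ (Valued.v ϖ ^ d)⁻¹ * Valued.v ϖ ^ d := mul_le_mul' le_rfl (hY 0 2)
      _ = 1 := inv_mul_cancel₀ (pow_ne_zero _ hvϖ0)
  have hz2 : Valued.v (z 2) = 1 := by
    by_contra hne
    have hlt : Valued.v (z 2) < 1 := lt_of_le_of_ne (hz1 2) hne
    have : Valued.v ((ϖ ^ d)⁻¹ * (z 2 ^ 2 * Y 0 2)) < 1 := by
      have e : (ϖ ^ d)⁻¹ * (z 2 ^ 2 * Y 0 2) = z 2 ^ 2 * ((ϖ ^ d)⁻¹ * Y 0 2) := by ring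
      rw [e, map_mul, map_pow]
      calc Valued.v (z 2) ^ 2 * Valued.v ((ϖ ^ d)⁻¹ * Y 0 2) ≤ Valued.v (z 2) ^ 2 * 1 := mul_le_mul' le_rfl hY02
        _ < 1 := by rw [mul_one]; exact pow_lt_one₀ zero_le hlt two_ne_zero
    exact (lt_irrefl _) (this.trans_eq hmain.symm)
  have hz20 : z 2 ≠ 0 := fun h0 => by rw [h0, map_zero] at hz2; exact zero_ne_one hz2
  refine ⟨a / z 2, by rw [map_div₀, ha, hz2, div_one], ?_⟩
  -- `(ϖ^d)⁻¹ Y₀₂ − c (a/z₂)² = z₂⁻² · ((ϖ^d)⁻¹ z₂² Y₀₂ − c a²)`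
  have e : (ϖ ^ d)⁻¹ * Y 0 2 - c * (a / z 2) ^ 2 = (z 2 ^ 2)⁻¹ * ((ϖ ^ d)⁻¹ * (z 2 ^ 2 * Y 0 2) - c * a ^ 2) := by
    field_simp
  rw [e, map_mul, map_inv₀, map_pow, hz2, one_pow, inv_one, one_mul]
  exact h2

/-- **ROW-P «ODD RANK-ONE VERTEX `P^c_{m+1}`: CLASS FLIP BY `−1`»** of the (a2) tree induction, token currency (J-PACK v2 §2, socket `row_P`): for a fixed self-dual
vertex `v ≠ r₀` of depth exactly `d ≥ 3` with `LEV₂[v](ϖ^{2d+1})` (rank `≤ 1`), `LEV₃[v](ϖ^{3d+1})`, class token `CLS[v] d c`, oriented by `(p, g, hup)`: every fixed grandchild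
`w ∈ GC(v)` has `LEV[w](ϖ^{d−2}) ∧ ¬LEV[w](ϖ^{d−1}) ∧ LEV₂[w](ϖ^{2d−3}) ∧ CLS[w] (d−2) (−c)`, and `#GC(v) = q²`.
[cite: Kottwitz1986, §3] [cite: Tits1979, §3.5] [cite: BruhatTits1972, §10] [cite: Serre1980Trees, II.1.1] -/
theorem fixedGrandchildren_tokens_and_ncard_of_rankOne (hσ : ∀ x, σ (σ x) = x) (hvσ : ∀ a, Valued.v (σ a) = Valued.v a) (hσϖ : σ ϖ = -ϖ)
    (hϖ : Valued.v ϖ = WithZero.exp (-1 : ℤ)) (hres : ∀ x : K, Valued.v x ≤ 1 → Valued.v (σ x - x) < 1) (h2 : Valued.v (2 : K) = 1) [Finite 𝓀[K]]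
    (hT : (latticeGraph σ ϖ ((StdForm.antidiagonal 3).over K)).IsTree)
    {γ : unitaryGroupOfForm σ ((StdForm.antidiagonal 3).over K)} (_hγ0 : γ ∈ unitaryInt σ ((StdForm.antidiagonal 3).over K))
    {v : {M : Submodule 𝒪[K] (Fin 3 → K) // IsVertex σ ϖ ((StdForm.antidiagonal 3).over K) M}}
    (hv : IsSelfDualLattice σ ϖ ((StdForm.antidiagonal 3).over K) v.1) (hvr : v ≠ ⟨stdLattice K 3, 0, isSelfDualLattice_stdLattice_three_of_v hϖ⟩)
    (hfix : latticeGraphIso σ ϖ ((StdForm.antidiagonal 3).over K) γ v = v)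
    {d : ℕ} (hd3 : 3 ≤ d) (hdo : Odd d)
    {p g : {M : Submodule 𝒪[K] (Fin 3 → K) // IsVertex σ ϖ ((StdForm.antidiagonal 3).over K) M}}
    (hp : (latticeGraph σ ϖ ((StdForm.antidiagonal 3).over K)).Adj v p)
    (hpin : (latticeGraph σ ϖ ((StdForm.antidiagonal 3).over K)).dist ⟨stdLattice K 3, 0, isSelfDualLattice_stdLattice_three_of_v hϖ⟩ p + 1 =
      (latticeGraph σ ϖ ((StdForm.antidiagonal 3).over K)).dist ⟨stdLattice K 3, 0, isSelfDualLattice_stdLattice_three_of_v hϖ⟩ v)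
    (hg : (latticeGraph σ ϖ ((StdForm.antidiagonal 3).over K)).Adj p g) (hgv : g ≠ v)
    (hup : g.1.map ((Matrix.toLin' (((γ : GL (Fin 3) K) : Matrix (Fin 3) (Fin 3) K) - 1)).restrictScalars 𝒪[K]) ≤ scaleLattice (ϖ ^ d) g.1)
    (hlev : v.1.map ((Matrix.toLin' (((γ : GL (Fin 3) K) : Matrix (Fin 3) (Fin 3) K) - 1)).restrictScalars 𝒪[K]) ≤ scaleLattice (ϖ ^ d) v.1)
    (hexact : ¬ v.1.map ((Matrix.toLin' (((γ : GL (Fin 3) K) : Matrix (Fin 3) (Fin 3) K) - 1)).restrictScalars 𝒪[K]) ≤ scaleLattice (ϖ ^ (d + 1)) v.1)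
    (hrk : v.1.map ((Matrix.toLin' ((((γ : GL (Fin 3) K) : Matrix (Fin 3) (Fin 3) K) - 1) ^ 2)).restrictScalars 𝒪[K]) ≤ scaleLattice (ϖ ^ (2 * d + 1)) v.1)
    (hnil : v.1.map ((Matrix.toLin' ((((γ : GL (Fin 3) K) : Matrix (Fin 3) (Fin 3) K) - 1) ^ 3)).restrictScalars 𝒪[K]) ≤ scaleLattice (ϖ ^ (3 * d + 1)) v.1)
    (c : K) (hc : Valued.v c = 1)
    (hcls : ∃ y ∈ v.1, ∃ a : K, Valued.v a = 1 ∧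
      Valued.v ((ϖ ^ (d))⁻¹ * pairing σ ((StdForm.antidiagonal 3).over K) y ((((γ : GL (Fin 3) K) : Matrix (Fin 3) (Fin 3) K) - 1) *ᵥ y) - (c) * a ^ 2) < 1) :
    (∀ w ∈ {w | ∃ c, ((latticeGraph σ ϖ ((StdForm.antidiagonal 3).over K)).Adj v c ∧
          (latticeGraph σ ϖ ((StdForm.antidiagonal 3).over K)).dist ⟨stdLattice K 3, 0, isSelfDualLattice_stdLattice_three_of_v hϖ⟩ c =
            (latticeGraph σ ϖ ((StdForm.antidiagonal 3).over K)).dist ⟨stdLattice K 3, 0, isSelfDualLattice_stdLattice_three_of_v hϖ⟩ v + 1 ∧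
          latticeGraphIso σ ϖ ((StdForm.antidiagonal 3).over K) γ c = c) ∧
        ((latticeGraph σ ϖ ((StdForm.antidiagonal 3).over K)).Adj c w ∧
          (latticeGraph σ ϖ ((StdForm.antidiagonal 3).over K)).dist ⟨stdLattice K 3, 0, isSelfDualLattice_stdLattice_three_of_v hϖ⟩ w =
            (latticeGraph σ ϖ ((StdForm.antidiagonal 3).over K)).dist ⟨stdLattice K 3, 0, isSelfDualLattice_stdLattice_three_of_v hϖ⟩ c + 1 ∧
          latticeGraphIso σ ϖ ((StdForm.antidiagonal 3).over K) γ w = w)},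
      w.1.map ((Matrix.toLin' (((γ : GL (Fin 3) K) : Matrix (Fin 3) (Fin 3) K) - 1)).restrictScalars 𝒪[K]) ≤ scaleLattice (ϖ ^ (d - 2)) w.1 ∧
      ¬ w.1.map ((Matrix.toLin' (((γ : GL (Fin 3) K) : Matrix (Fin 3) (Fin 3) K) - 1)).restrictScalars 𝒪[K]) ≤ scaleLattice (ϖ ^ (d - 1)) w.1 ∧
      w.1.map ((Matrix.toLin' ((((γ : GL (Fin 3) K) : Matrix (Fin 3) (Fin 3) K) - 1) ^ 2)).restrictScalars 𝒪[K]) ≤ scaleLattice (ϖ ^ (2 * d - 3)) w.1 ∧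
      (∃ y ∈ w.1, ∃ a : K, Valued.v a = 1 ∧
        Valued.v ((ϖ ^ (d - 2))⁻¹ * pairing σ ((StdForm.antidiagonal 3).over K) y ((((γ : GL (Fin 3) K) : Matrix (Fin 3) (Fin 3) K) - 1) *ᵥ y) - (-c) * a ^ 2) < 1)) ∧
    {w | ∃ c, ((latticeGraph σ ϖ ((StdForm.antidiagonal 3).over K)).Adj v c ∧
          (latticeGraph σ ϖ ((StdForm.antidiagonal 3).over K)).dist ⟨stdLattice K 3, 0, isSelfDualLattice_stdLattice_three_of_v hϖ⟩ c =
            (latticeGraph σ ϖ ((StdForm.antidiagonal 3).over K)).dist ⟨stdLattice K 3, 0, isSelfDualLattice_stdLattice_three_of_v hϖ⟩ v + 1 ∧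
          latticeGraphIso σ ϖ ((StdForm.antidiagonal 3).over K) γ c = c) ∧
        ((latticeGraph σ ϖ ((StdForm.antidiagonal 3).over K)).Adj c w ∧
          (latticeGraph σ ϖ ((StdForm.antidiagonal 3).over K)).dist ⟨stdLattice K 3, 0, isSelfDualLattice_stdLattice_three_of_v hϖ⟩ w =
            (latticeGraph σ ϖ ((StdForm.antidiagonal 3).over K)).dist ⟨stdLattice K 3, 0, isSelfDualLattice_stdLattice_three_of_v hϖ⟩ c + 1 ∧
          latticeGraphIso σ ϖ ((StdForm.antidiagonal 3).over K) γ w = w)}.ncard = Nat.card 𝓀[K] ^ 2 := by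
  have hϖ0 : ϖ ≠ 0 := fun h0 => by rw [h0, map_zero] at hϖ; exact WithZero.coe_ne_zero hϖ.symm
  have hvϖ0 : Valued.v ϖ ≠ 0 := (Valuation.ne_zero_iff _).2 hϖ0
  have hϖ1 : Valued.v ϖ ≤ 1 := by rw [hϖ, ← WithZero.exp_zero]; exact WithZero.exp_le_exp.2 (by norm_num)
  have hϖlt : Valued.v ϖ < 1 := by rw [hϖ, ← WithZero.exp_zero]; exact WithZero.exp_lt_exp.2 (by norm_num)
  have hd1 : 1 ≤ d := by omega
  have hd2 : 2 ≤ d := by omega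
  have hpowle : ∀ {m n : ℕ}, n ≤ m → Valued.v ϖ ^ m ≤ Valued.v ϖ ^ n := fun {m n} h => pow_le_pow_right_of_le_one' hϖ1 h
  have hdm : Valued.v ϖ ^ d = Valued.v ϖ ^ (d + 1) * WithZero.exp (1 : ℤ) := by
    rw [pow_succ, hϖ, mul_assoc, ← WithZero.exp_add]; norm_num
  -- the frame of `v`
  obtain ⟨u, hu⟩ := exists_latticeGraphIso_root_eq_of_v_two hσ hvσ hϖ h2 v hv (isSelfDualLattice_stdLattice_three_of_v hϖ)
  subst hu
  have hframe : ∀ {κ : unitaryGroupOfForm σ ((StdForm.antidiagonal 3).over K)}, κ ∈ unitaryInt σ ((StdForm.antidiagonal 3).over K) →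
      latticeGraphIso σ ϖ ((StdForm.antidiagonal 3).over K) (u * κ) ⟨stdLattice K 3, 0, isSelfDualLattice_stdLattice_three_of_v hϖ⟩ =
        latticeGraphIso σ ϖ ((StdForm.antidiagonal 3).over K) u ⟨stdLattice K 3, 0, isSelfDualLattice_stdLattice_three_of_v hϖ⟩ := fun {κ} hκ => by
    rw [latticeGraphIso_mul_apply, latticeGraphIso_root_eq_of_mem_unitaryInt hϖ hκ]
  -- token ↔ matrix dictionary in the frame `u * κ` (★ G3⁵), powers 1, 2, 3, and exact depth
  have hY : ∀ {κ : unitaryGroupOfForm σ ((StdForm.antidiagonal 3).over K)}, κ ∈ unitaryInt σ ((StdForm.antidiagonal 3).over K) →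
      ∀ i j, Valued.v ((((((u * κ)⁻¹ * γ * (u * κ) : unitaryGroupOfForm σ ((StdForm.antidiagonal 3).over K)) : GL (Fin 3) K) : Matrix (Fin 3) (Fin 3) K) - 1) i j) ≤ Valued.v ϖ ^ d := fun {κ} hκ => by
    have h := (map_pow_le_scaleLattice_latticeGraphIso_root_iff hϖ γ (u * κ) (pow_ne_zero d hϖ0) 1).1 (by rw [pow_one, hframe hκ]; exact hlev)
    simpa only [pow_one, map_pow] using h
  have hY2 : ∀ {κ : unitaryGroupOfForm σ ((StdForm.antidiagonal 3).over K)}, κ ∈ unitaryInt σ ((StdForm.antidiagonal 3).over K) →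
      ∀ i j, Valued.v (((((((u * κ)⁻¹ * γ * (u * κ) : unitaryGroupOfForm σ ((StdForm.antidiagonal 3).over K)) : GL (Fin 3) K) : Matrix (Fin 3) (Fin 3) K) - 1) *
        (((((u * κ)⁻¹ * γ * (u * κ) : unitaryGroupOfForm σ ((StdForm.antidiagonal 3).over K)) : GL (Fin 3) K) : Matrix (Fin 3) (Fin 3) K) - 1)) i j) ≤ Valued.v ϖ ^ (2 * d + 1) := fun {κ} hκ => by
    have h := (map_pow_le_scaleLattice_latticeGraphIso_root_iff hϖ γ (u * κ) (pow_ne_zero _ hϖ0) 2).1 (by rw [hframe hκ]; exact hrk)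
    simpa only [pow_two, map_pow] using h
  have hY3 : ∀ {κ : unitaryGroupOfForm σ ((StdForm.antidiagonal 3).over K)}, κ ∈ unitaryInt σ ((StdForm.antidiagonal 3).over K) →
      ∀ i j, Valued.v (((((((u * κ)⁻¹ * γ * (u * κ) : unitaryGroupOfForm σ ((StdForm.antidiagonal 3).over K)) : GL (Fin 3) K) : Matrix (Fin 3) (Fin 3) K) - 1) *
        (((((u * κ)⁻¹ * γ * (u * κ) : unitaryGroupOfForm σ ((StdForm.antidiagonal 3).over K)) : GL (Fin 3) K) : Matrix (Fin 3) (Fin 3) K) - 1) *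
        (((((u * κ)⁻¹ * γ * (u * κ) : unitaryGroupOfForm σ ((StdForm.antidiagonal 3).over K)) : GL (Fin 3) K) : Matrix (Fin 3) (Fin 3) K) - 1)) i j) ≤ Valued.v ϖ ^ (3 * d + 1) := fun {κ} hκ => by
    have h := (map_pow_le_scaleLattice_latticeGraphIso_root_iff hϖ γ (u * κ) (pow_ne_zero _ hϖ0) 3).1 (by rw [hframe hκ]; exact hnil)
    simpa only [pow_three', map_pow] using h
  have hYne : ∀ {κ : unitaryGroupOfForm σ ((StdForm.antidiagonal 3).over K)}, κ ∈ unitaryInt σ ((StdForm.antidiagonal 3).over K) →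
      ¬ ∀ i j, Valued.v ((((((u * κ)⁻¹ * γ * (u * κ) : unitaryGroupOfForm σ ((StdForm.antidiagonal 3).over K)) : GL (Fin 3) K) : Matrix (Fin 3) (Fin 3) K) - 1) i j) ≤ Valued.v ϖ ^ (d + 1) := fun {κ} hκ h => by
    apply hexact
    have h' := (map_pow_le_scaleLattice_latticeGraphIso_root_iff hϖ γ (u * κ) (pow_ne_zero (d + 1) hϖ0) 1).2 (by simpa only [pow_one, map_pow] using h)
    rwa [pow_one, hframe hκ] at h'
  -- ORIENTATION: the inward frame `u₀ = uκ₀`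
  obtain ⟨κ₀, hκ₀, a₀, b₀, ha₀, hb₀, hp_eq, hg_eq⟩ := exists_frame_of_adj_adj hσ hvσ hσϖ hϖ hres h2 u rfl hp hg hgv
  set γ₀ : unitaryGroupOfForm σ ((StdForm.antidiagonal 3).over K) := (u * κ₀)⁻¹ * γ * (u * κ₀) with hγ₀def
  have hM₀ : (((γ₀ : GL (Fin 3) K) : Matrix (Fin 3) (Fin 3) K) - 1) = (((((u * κ₀ : unitaryGroupOfForm σ ((StdForm.antidiagonal 3).over K)) : GL (Fin 3) K)⁻¹ : GL (Fin 3) K) : Matrix (Fin 3) (Fin 3) K) * (((γ : GL (Fin 3) K) : Matrix (Fin 3) (Fin 3) K) - 1) * (((u * κ₀ : unitaryGroupOfForm σ ((StdForm.antidiagonal 3).over K)) : GL (Fin 3) K) : Matrix (Fin 3) (Fin 3) K)) := coe_inv_mul_mul_sub_one γ (u * κ₀)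
  have hY₀ : ∀ i j, Valued.v ((((((u * κ₀ : unitaryGroupOfForm σ ((StdForm.antidiagonal 3).over K)) : GL (Fin 3) K)⁻¹ : GL (Fin 3) K) : Matrix (Fin 3) (Fin 3) K) * (((γ : GL (Fin 3) K) : Matrix (Fin 3) (Fin 3) K) - 1) * (((u * κ₀ : unitaryGroupOfForm σ ((StdForm.antidiagonal 3).over K)) : GL (Fin 3) K) : Matrix (Fin 3) (Fin 3) K)) i j) ≤ Valued.v ϖ ^ d := fun i j => by rw [← hM₀]; exact hY hκ₀ i j
  have hY₀2 : ∀ i j, Valued.v (((((((u * κ₀ : unitaryGroupOfForm σ ((StdForm.antidiagonal 3).over K)) : GL (Fin 3) K)⁻¹ : GL (Fin 3) K) : Matrix (Fin 3) (Fin 3) K) * (((γ : GL (Fin 3) K) : Matrix (Fin 3) (Fin 3) K) - 1) * (((u * κ₀ : unitaryGroupOfForm σ ((StdForm.antidiagonal 3).over K)) : GL (Fin 3) K) : Matrix (Fin 3) (Fin 3) K)) * (((((u * κ₀ : unitaryGroupOfForm σ ((StdForm.antidiagonal 3).over K)) : GL (Fin 3) K)⁻¹ : GL (Fin 3) K) :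 Matrix (Fin 3) (Fin 3) K) * (((γ : GL (Fin 3) K) : Matrix (Fin 3) (Fin 3) K) - 1) * (((u * κ₀ : unitaryGroupOfForm σ ((StdForm.antidiagonal 3).over K)) : GL (Fin 3) K) : Matrix (Fin 3) (Fin 3) K))) i j) ≤ Valued.v ϖ ^ (2 * d + 1) := fun i j => by rw [← hM₀]; exact hY2 hκ₀ i j
  have hY₀3 : ∀ i j, Valued.v (((((((u * κ₀ : unitaryGroupOfForm σ ((StdForm.antidiagonal 3).over K)) : GL (Fin 3) K)⁻¹ : GL (Fin 3) K) : Matrix (Fin 3) (Fin 3) K) * (((γ : GL (Fin 3) K) : Matrix (Fin 3) (Fin 3) K) - 1) * (((u * κ₀ : unitaryGroupOfForm σ ((StdForm.antidiagonal 3).over K)) : GL (Fin 3) K) : Matrix (Fin 3) (Fin 3) K)) * (((((u * κ₀ : unitaryGroupOfForm σ ((StdForm.antidiagonal 3).over K)) : GL (Fin 3) K)⁻¹ : GL (Fin 3) K) : Matrix (Fin 3) (Fin 3) K) * (((γ : GL (Fin 3) K) : Matrix (Fin 3) (Fin 3) K) - 1) * (((u * κ₀ : unitaryGroupOfForm σ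 ((StdForm.antidiagonal 3).over K)) : GL (Fin 3) K) : Matrix (Fin 3) (Fin 3) K)) * (((((u * κ₀ : unitaryGroupOfForm σ ((StdForm.antidiagonal 3).over K)) : GL (Fin 3) K)⁻¹ : GL (Fin 3) K) : Matrix (Fin 3) (Fin 3) K) * (((γ : GL (Fin 3) K) : Matrix (Fin 3) (Fin 3) K) - 1) * (((u * κ₀ : unitaryGroupOfForm σ ((StdForm.antidiagonal 3).over K)) : GL (Fin 3) K) : Matrix (Fin 3) (Fin 3) K))) i j) ≤ Valued.v ϖ ^ (3 * d + 1) := fun i j => by rw [← hM₀]; exact hY3 hκ₀ i j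
  -- the inward line is in the kernel (★ J §1 + §2)
  have hcol₀ : ∀ i, Valued.v ((((((u * κ₀ : unitaryGroupOfForm σ ((StdForm.antidiagonal 3).over K)) : GL (Fin 3) K)⁻¹ : GL (Fin 3) K) : Matrix (Fin 3) (Fin 3) K) * (((γ : GL (Fin 3) K) : Matrix (Fin 3) (Fin 3) K) - 1) * (((u * κ₀ : unitaryGroupOfForm σ ((StdForm.antidiagonal 3).over K)) : GL (Fin 3) K) : Matrix (Fin 3) (Fin 3) K)) i 0) ≤ Valued.v ϖ ^ (d + 1) := by
    have hup' := hup
    rw [hg_eq] at hup'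
    obtain ⟨h10, -, h20⟩ := v_apply_le_succ_of_map_sub_one_childLatt_le hϖ ((u * κ₀ : unitaryGroupOfForm σ ((StdForm.antidiagonal 3).over K)) : GL (Fin 3) K) (γ : GL (Fin 3) K) ha₀ hb₀ hd1 hY₀ hup'
    by_contra hnot
    rw [not_forall] at hnot
    obtain ⟨i, hi⟩ := hnot
    have hpiv := v_one_zero_eq_of_cube_le_of_corner hϖ hY₀ hY₀3 h20 (fun h => hi (h i))
    have hlt : Valued.v ϖ ^ (d + 1) < Valued.v ϖ ^ d := by
      rw [pow_succ]; exact mul_lt_of_lt_one_right (zero_lt_iff.2 (pow_ne_zero _ hvϖ0)) hϖlt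
    exact (lt_irrefl _) ((h10.trans_lt hlt).trans_eq hpiv.symm)
  -- the RANK-ONE SHAPE `Ȳ₀ = s·E₀₂` (★ K), exact depth `|Y₀ 0 2| = |ϖ|^d`, and the class of `Y₀ 0 2`
  have hshape : ∀ i j : Fin 3, ¬ (i = 0 ∧ j = 2) → Valued.v ((((((u * κ₀ : unitaryGroupOfForm σ ((StdForm.antidiagonal 3).over K)) : GL (Fin 3) K)⁻¹ : GL (Fin 3) K) : Matrix (Fin 3) (Fin 3) K) * (((γ : GL (Fin 3) K) : Matrix (Fin 3) (Fin 3) K) - 1) * (((u * κ₀ : unitaryGroupOfForm σ ((StdForm.antidiagonal 3).over K)) : GL (Fin 3) K) : Matrix (Fin 3) (Fin 3) K)) i j) ≤ Valued.v ϖ ^ (d + 1) := by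
    intro i j hij
    have h := forall_v_coe_sub_one_le_succ_of_sq_le_of_col hvσ hσϖ hϖ hres γ₀ hdo (fun i j => by rw [hM₀]; exact hY₀ i j)
      (fun i j => by rw [hM₀]; exact hY₀2 i j) (fun i => by rw [hM₀]; exact hcol₀ i) hij
    rwa [hM₀] at h
  have h02 : Valued.v ((((((u * κ₀ : unitaryGroupOfForm σ ((StdForm.antidiagonal 3).over K)) : GL (Fin 3) K)⁻¹ : GL (Fin 3) K) : Matrix (Fin 3) (Fin 3) K) * (((γ : GL (Fin 3) K) : Matrix (Fin 3) (Fin 3) K) - 1) * (((u * κ₀ : unitaryGroupOfForm σ ((StdForm.antidiagonal 3).over K)) : GL (Fin 3) K) : Matrix (Fin 3) (Fin 3) K)) 0 2) = Valued.v ϖ ^ d := by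
    by_contra hne
    have h' : Valued.v ((((((u * κ₀ : unitaryGroupOfForm σ ((StdForm.antidiagonal 3).over K)) : GL (Fin 3) K)⁻¹ : GL (Fin 3) K) : Matrix (Fin 3) (Fin 3) K) * (((γ : GL (Fin 3) K) : Matrix (Fin 3) (Fin 3) K) - 1) * (((u * κ₀ : unitaryGroupOfForm σ ((StdForm.antidiagonal 3).over K)) : GL (Fin 3) K) : Matrix (Fin 3) (Fin 3) K)) 0 2) < Valued.v ϖ ^ d := lt_of_le_of_ne (hY₀ 0 2) hne
    rw [hdm] at h'
    have h02' := (WithZero.lt_mul_exp_iff_le (pow_ne_zero _ hvϖ0)).1 h'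
    apply hYne hκ₀
    intro i j
    rw [hM₀]
    by_cases hij : i = 0 ∧ j = 2
    · obtain ⟨rfl, rfl⟩ := hij; exact h02'
    · exact hshape i j hij
  have hcls' : ∃ y ∈ latt (((u * κ₀ : unitaryGroupOfForm σ ((StdForm.antidiagonal 3).over K)) : GL (Fin 3) K) : Matrix (Fin 3) (Fin 3) K), ∃ a : K, Valued.v a = 1 ∧
      Valued.v ((ϖ ^ d)⁻¹ * pairing σ ((StdForm.antidiagonal 3).over K) y ((((γ : GL (Fin 3) K) : Matrix (Fin 3) (Fin 3) K) - 1) *ᵥ y) - c * a ^ 2) < 1 := by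
    have e : latt (((u * κ₀ : unitaryGroupOfForm σ ((StdForm.antidiagonal 3).over K)) : GL (Fin 3) K) : Matrix (Fin 3) (Fin 3) K) = (latticeGraphIso σ ϖ ((StdForm.antidiagonal 3).over K) u ⟨stdLattice K 3, 0, isSelfDualLattice_stdLattice_three_of_v hϖ⟩).1 := by
      rw [← hframe hκ₀]; rfl
    rw [e]; exact hcls
  obtain ⟨a₁, ha₁, hcl₁⟩ := exists_unit_class_of_cls_of_shape hvσ hϖ hres (u * κ₀) γ hY₀ hshape hc hcls'
  refine ⟨?_, ?_⟩
  · -- LABELS of a grandchild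
    rintro w ⟨c', ⟨hvc, hdc, -⟩, hcw, hdw, -⟩
    have hne : w ≠ latticeGraphIso σ ϖ ((StdForm.antidiagonal 3).over K) u ⟨stdLattice K 3, 0, isSelfDualLattice_stdLattice_three_of_v hϖ⟩ := by
      intro h; rw [h] at hdw; omega
    obtain ⟨κ, hκ, a, b, ha, hb, hc_eq, hw_eq⟩ := exists_frame_of_adj_adj hσ hvσ hσϖ hϖ hres h2 u rfl hvc hcw hne
    have hcp : c' ≠ p := by intro h; rw [h] at hdc; omega
    set k : unitaryGroupOfForm σ ((StdForm.antidiagonal 3).over K) := κ₀⁻¹ * κ with hkdef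
    have hk : k ∈ unitaryInt σ ((StdForm.antidiagonal 3).over K) := Subgroup.mul_mem _ (Subgroup.inv_mem _ hκ₀) hκ
    have hk1 : Valued.v (((k : GL (Fin 3) K) : Matrix (Fin 3) (Fin 3) K) 2 0) ≤ 1 := (mem_unitaryInt_iff.1 hk).1 2 0
    have hkN : ¬ Valued.v (((k : GL (Fin 3) K) : Matrix (Fin 3) (Fin 3) K) 2 0) < 1 := by
      intro hlt
      have hkN₁ := (mapGL_N₁_eq_iff_v_apply_two_zero_lt_one hvσ hϖ hk).2 hlt
      apply hcp
      rw [hc_eq, hp_eq, show u * κ = u * κ₀ * k by rw [hkdef, mul_assoc, mul_inv_cancel_left], latticeGraphIso_mul_apply]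
      congr 1
      exact Subtype.ext (by rw [latticeGraphIso_apply_val]; exact hkN₁)
    have hk20 : Valued.v (((k : GL (Fin 3) K) : Matrix (Fin 3) (Fin 3) K) 2 0) = 1 := le_antisymm hk1 (not_lt.1 hkN)
    -- the matrix in the frame `uκ = u₀k` is `k⁻¹Y₀k`
    have hconj : (u * κ)⁻¹ * γ * (u * κ) = k⁻¹ * γ₀ * k := by
      rw [hγ₀def, show u * κ = u * κ₀ * k by rw [hkdef, mul_assoc, mul_inv_cancel_left]]
      exact conj_mul_eq_inv_mul_conj_mul γ (u * κ₀) k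
    have hMk : (((((u * κ : unitaryGroupOfForm σ ((StdForm.antidiagonal 3).over K)) : GL (Fin 3) K)⁻¹ : GL (Fin 3) K) : Matrix (Fin 3) (Fin 3) K) * (((γ : GL (Fin 3) K) : Matrix (Fin 3) (Fin 3) K) - 1) * (((u * κ : unitaryGroupOfForm σ ((StdForm.antidiagonal 3).over K)) : GL (Fin 3) K) : Matrix (Fin 3) (Fin 3) K)) =
        (((k : GL (Fin 3) K)⁻¹ : GL (Fin 3) K) : Matrix (Fin 3) (Fin 3) K) * (((((u * κ₀ : unitaryGroupOfForm σ ((StdForm.antidiagonal 3).over K)) : GL (Fin 3) K)⁻¹ : GL (Fin 3) K) : Matrix (Fin 3) (Fin 3) K) * (((γ : GL (Fin 3) K) : Matrix (Fin 3) (Fin 3) K) - 1) * (((u * κ₀ : unitaryGroupOfForm σ ((StdForm.antidiagonal 3).over K)) : GL (Fin 3) K) : Matrix (Fin 3) (Fin 3) K)) * ((k : GL (Fin 3) K) : Matrix (Fin 3) (Fin 3) K) := by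
      rw [← coe_inv_mul_mul_sub_one γ (u * κ), ← hM₀, ← coe_inv_mul_mul_sub_one γ₀ k, hconj]
    have hM : ∀ i j, Valued.v ((((((u * κ : unitaryGroupOfForm σ ((StdForm.antidiagonal 3).over K)) : GL (Fin 3) K)⁻¹ : GL (Fin 3) K) : Matrix (Fin 3) (Fin 3) K) * (((γ : GL (Fin 3) K) : Matrix (Fin 3) (Fin 3) K) - 1) * (((u * κ : unitaryGroupOfForm σ ((StdForm.antidiagonal 3).over K)) : GL (Fin 3) K) : Matrix (Fin 3) (Fin 3) K)) i j) ≤ Valued.v ϖ ^ d := fun i j => by rw [← coe_inv_mul_mul_sub_one γ (u * κ)]; exact hY hκ i j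
    -- the corner at `κ`: a UNIT multiple of `ϖ^d` (★ K), of class `c`
    have h20 : ¬ Valued.v ((((((u * κ : unitaryGroupOfForm σ ((StdForm.antidiagonal 3).over K)) : GL (Fin 3) K)⁻¹ : GL (Fin 3) K) : Matrix (Fin 3) (Fin 3) K) * (((γ : GL (Fin 3) K) : Matrix (Fin 3) (Fin 3) K) - 1) * (((u * κ : unitaryGroupOfForm σ ((StdForm.antidiagonal 3).over K)) : GL (Fin 3) K) : Matrix (Fin 3) (Fin 3) K)) 2 0) ≤ Valued.v ϖ ^ (d + 1) := by
      rw [hMk]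
      exact fun h => hkN ((v_conj_apply_two_zero_le_iff_of_shape hvσ hϖ hres hY₀ hshape h02 hk).1 h)
    have hcorner := v_conj_apply_two_zero_sub_lt_of_shape hvσ hϖ hres hY₀ hshape hk
    have hs : ∃ a₂ : K, Valued.v a₂ = 1 ∧ Valued.v ((ϖ ^ d)⁻¹ * (((((u * κ : unitaryGroupOfForm σ ((StdForm.antidiagonal 3).over K)) : GL (Fin 3) K)⁻¹ : GL (Fin 3) K) : Matrix (Fin 3) (Fin 3) K) * (((γ : GL (Fin 3) K) : Matrix (Fin 3) (Fin 3) K) - 1) * (((u * κ : unitaryGroupOfForm σ ((StdForm.antidiagonal 3).over K)) : GL (Fin 3) K) : Matrix (Fin 3) (Fin 3) K)) 2 0 - c * a₂ ^ 2) < 1 := by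
      refine ⟨((k : GL (Fin 3) K) : Matrix (Fin 3) (Fin 3) K) 2 0 * a₁, by rw [map_mul, hk20, ha₁, one_mul], ?_⟩
      rw [hMk]
      have hpd : Valued.v ((ϖ ^ d)⁻¹) = (Valued.v ϖ ^ d)⁻¹ := by rw [map_inv₀, map_pow]
      -- `(ϖ^d)⁻¹·corner − c(k₂₀a₁)² = (ϖ^d)⁻¹(corner − k₂₀²Y₀₂) + k₂₀²((ϖ^d)⁻¹Y₀₂ − c a₁²)`
      have e : (ϖ ^ d)⁻¹ * ((((k : GL (Fin 3) K)⁻¹ : GL (Fin 3) K) : Matrix (Fin 3) (Fin 3) K) * (((((u * κ₀ : unitaryGroupOfForm σ ((StdForm.antidiagonal 3).over K)) : GL (Fin 3) K)⁻¹ : GL (Fin 3) K) : Matrix (Fin 3) (Fin 3) K) * (((γ : GL (Fin 3) K) : Matrix (Fin 3) (Fin 3) K) - 1) * (((u * κ₀ : unitaryGroupOfForm σ ((StdForm.antidiagonal 3).over K)) : GL (Fin 3) K) : Matrix (Fin 3) (Fin 3) K)) * ((k : GL (Fin 3) K) : Matrix (Fin 3) (Fin 3) K)) 2 0 -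
          c * (((k : GL (Fin 3) K) : Matrix (Fin 3) (Fin 3) K) 2 0 * a₁) ^ 2 =
          (ϖ ^ d)⁻¹ * (((((k : GL (Fin 3) K)⁻¹ : GL (Fin 3) K) : Matrix (Fin 3) (Fin 3) K) * (((((u * κ₀ : unitaryGroupOfForm σ ((StdForm.antidiagonal 3).over K)) : GL (Fin 3) K)⁻¹ : GL (Fin 3) K) : Matrix (Fin 3) (Fin 3) K) * (((γ : GL (Fin 3) K) : Matrix (Fin 3) (Fin 3) K) - 1) * (((u * κ₀ : unitaryGroupOfForm σ ((StdForm.antidiagonal 3).over K)) : GL (Fin 3) K) : Matrix (Fin 3) (Fin 3) K)) * ((k : GL (Fin 3) K) : Matrix (Fin 3) (Fin 3) K)) 2 0 -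
            ((k : GL (Fin 3) K) : Matrix (Fin 3) (Fin 3) K) 2 0 ^ 2 * (((((u * κ₀ : unitaryGroupOfForm σ ((StdForm.antidiagonal 3).over K)) : GL (Fin 3) K)⁻¹ : GL (Fin 3) K) : Matrix (Fin 3) (Fin 3) K) * (((γ : GL (Fin 3) K) : Matrix (Fin 3) (Fin 3) K) - 1) * (((u * κ₀ : unitaryGroupOfForm σ ((StdForm.antidiagonal 3).over K)) : GL (Fin 3) K) : Matrix (Fin 3) (Fin 3) K)) 0 2) +
          ((k : GL (Fin 3) K) : Matrix (Fin 3) (Fin 3) K) 2 0 ^ 2 * ((ϖ ^ d)⁻¹ * (((((u * κ₀ : unitaryGroupOfForm σ ((StdForm.antidiagonal 3).over K)) : GL (Fin 3) K)⁻¹ : GL (Fin 3) K) : Matrix (Fin 3) (Fin 3) K) * (((γ : GL (Fin 3) K) : Matrix (Fin 3) (Fin 3) K) - 1) * (((u * κ₀ : unitaryGroupOfForm σ ((StdForm.antidiagonal 3).over K)) : GL (Fin 3) K) : Matrix (Fin 3) (Fin 3) K)) 0 2 - c * a₁ ^ 2) := by ring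
      rw [e]
      refine Valuation.map_add_lt _ ?_ ?_
      · rw [map_mul, hpd]
        calc (Valued.v ϖ ^ d)⁻¹ * Valued.v _ < (Valued.v ϖ ^ d)⁻¹ * Valued.v ϖ ^ d :=
              mul_lt_mul_of_pos_left hcorner (zero_lt_iff.2 (inv_ne_zero (pow_ne_zero _ hvϖ0)))
          _ = 1 := inv_mul_cancel₀ (pow_ne_zero _ hvϖ0)
      · rw [map_mul, map_pow, hk20, one_pow, one_mul]; exact hcl₁
    -- the four tokens at `w` (★ H)
    have hlevpp := map_sub_one_childLatt_le_scaleLattice_pred_pred hϖ ((u * κ : unitaryGroupOfForm σ ((StdForm.antidiagonal 3).over K)) : GL (Fin 3) K) (γ : GL (Fin 3) K) ha hb hd2 hM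
    have hnotlev : ¬ (latt ((((u * κ : unitaryGroupOfForm σ ((StdForm.antidiagonal 3).over K)) : GL (Fin 3) K) : Matrix (Fin 3) (Fin 3) K) * !![a / ϖ, 0, 0; 0, 1, 0; b, 0, ϖ])).map
          ((Matrix.toLin' (((γ : GL (Fin 3) K) : Matrix (Fin 3) (Fin 3) K) - 1)).restrictScalars 𝒪[K]) ≤
        scaleLattice (ϖ ^ (d - 1)) (latt ((((u * κ : unitaryGroupOfForm σ ((StdForm.antidiagonal 3).over K)) : GL (Fin 3) K) : Matrix (Fin 3) (Fin 3) K) * !![a / ϖ, 0, 0; 0, 1, 0; b, 0, ϖ])) :=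
      fun h => h20 ((map_sub_one_childLatt_le_scaleLattice_pred_iff hϖ ((u * κ : unitaryGroupOfForm σ ((StdForm.antidiagonal 3).over K)) : GL (Fin 3) K) (γ : GL (Fin 3) K) ha hb hd1 hM).1 h)
    have hlev₂ := map_sub_one_sq_childLatt_le_scaleLattice_of_le hϖ ((u * κ : unitaryGroupOfForm σ ((StdForm.antidiagonal 3).over K)) : GL (Fin 3) K) (γ : GL (Fin 3) K) ha hb hd2 hM
    have hclass := exists_mem_childLatt_class_neg_of_lineClass hvσ hσϖ hϖ hres (u * κ) γ ha hb hd2 hM hs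
    rw [hw_eq]
    exact ⟨hlevpp, hnotlev, hlev₂, hclass⟩
  · -- COUNT (★ G3⁺): `LEV[v](ϖ²)` from `d ≥ 3`
    have hlev2 : (latticeGraphIso σ ϖ ((StdForm.antidiagonal 3).over K) u ⟨stdLattice K 3, 0, isSelfDualLattice_stdLattice_three_of_v hϖ⟩).1.map
          ((Matrix.toLin' (((γ : GL (Fin 3) K) : Matrix (Fin 3) (Fin 3) K) - 1)).restrictScalars 𝒪[K]) ≤
        scaleLattice (ϖ ^ 2) (latticeGraphIso σ ϖ ((StdForm.antidiagonal 3).over K) u ⟨stdLattice K 3, 0, isSelfDualLattice_stdLattice_three_of_v hϖ⟩).1 := by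
      have h1 := (forall_v_conj_sub_one_le_iff_map_sub_one_le_scaleLattice γ u (pow_ne_zero d hϖ0)).1 hlev
      exact (forall_v_conj_sub_one_le_iff_map_sub_one_le_scaleLattice γ u (pow_ne_zero 2 hϖ0)).2
        (fun i j => (h1 i j).trans (by rw [map_pow, map_pow]; exact hpowle hd2))
    exact ncard_fixedGrandchildren_eq_sq_of_level_two hσ hvσ hσϖ hϖ hres h2 hT hv hvr hfix hlev2

end Literature.NumberTheory.Automorphic.UnitaryLatticeTree

end
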